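import Mathlib
import Summits.ResolutionOfSingularities.ResolutionOfSingularities.Theorems.WildQuotientsWildQuotientResolutionJordanFourChartTTwisted

/-!
# V4U T2(b) in the letters of the `H₁` brick: `(k[x][I₆t])_{(T′t·H′³t²)} ≃ k[evenGens, 1/Q] ⊆ L` for ANY model `L` of `k[x][1/Q]`

(crux stmt-ResolutionOfSingularities-15640 `WildQuotients.WildQuotientResolution`, line `Sketch`,
sector `|G| = p`; programme V4U of `L/w45c/CHAIN.md` v7.7 §4 — res-L1-w45c-plan-1's named object
2026-08-27T07:13:11Z (a) / RULING 07:47Z, follow-up: the T2(b) instance of record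
`JordanFour.exists_chartW_away_ringEquiv_twistedChart` (…JordanFourChartTTwisted) re-lettered for
res-type-036's ring brick `JordanFour.exists_ringBrick_T_model` (…JordanFourHalfChartRing), which takes
an arbitrary `L` with `IsLocalization.Away (JordanFour.twistedQ k n a b d) L` and
`E = Algebra.adjoin k (algebraMap '' JordanFour.evenGens k n a b c ∪ {invSelf (twistedQ …)})`, a ring
`C` with `base : k[x] →+* C`, `eE : C ≃+* ↥E` and `hbase : ∀ F, ↑(eE (base F)) = algebraMap (ψ_T F)`.
[OURS · L1 W4.5c] — NOT a statement of any manuscript; replaces the role of no printed item.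
Prover res-L1-w45c-stub-1.)

* `JordanFour.exists_chartW_away_ringEquiv_evenModel` — at `C := (k[x][I₆t])_{(T′t·H′³t²)}`,
  `base := fromZeroRingHom ∘ zeroRingHom`: `∃ eE : C ≃+* ↥E` with `hbase`, plus the values on the
  `T′`-chart ratios (`(g_jt)/(T′t) ↦ q_j/Q`) and on `θ` (`↦ Q`). Transport of the engine-lettered
  instance along `IsLocalization.algEquiv : k[x][1/Qp] ≃ₐ L` (`Qp = twistedQ`, `twistedQ_eq_engineQ`;
  literal generators `=` `evenGens`, `engineGens_eq_evenGens`).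
* helpers `engineGens_eq_evenGens`, `exists_subalgebra_ringEquiv_of_map_eq` (generic transport of a
  subalgebra along an algebra isomorphism).
-/

-- single-problem summit: the doubled namespace component `ResolutionOfSingularities` is forced
set_option linter.dupNamespace false

noncomputable section

open MvPolynomial IsLocalization Polynomial HomogeneousLocalization Literature.AlgebraicGeometry.Resolution

namespace Summit.ResolutionOfSingularities.ResolutionOfSingularities.Theorems.WildQuotientResolution.JordanFour

variable (k : Type) [Field k] (n : ℕ) (a b c d : Fin n)
  (hab : a ≠ b) (hac : a ≠ c) (had : a ≠ d) (hbc : b ≠ c) (hbd : b ≠ d) (hcd : c ≠ d)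

local notation3 "gI6" => (![X a ^ 2, X a * X b ^ 2, X a * X b * X c, X a * X c ^ 3, X b ^ 3,
  X b ^ 2 * X c ^ 2, X b * X c ^ 4, X c ^ 6] : Fin 8 → MvPolynomial (Fin n) k)
local notation3 "I6" => Ideal.span (Set.range gI6)
local notation3 "Qp" => (1 - 3 * X b * X a + X a ^ 2 * X d : MvPolynomial (Fin n) k)
local notation3 "Egens" => (({X b ^ 2, X b * X a, X b * X c, X a ^ 2, X a * X c, X c ^ 2} :
    Set (MvPolynomial (Fin n) k)) ∪ (fun i : Fin n => (X i : MvPolynomial (Fin n) k)) '' {i | i ≠ a ∧ i ≠ b ∧ i ≠ c})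
local notation3 "LQ" => Localization.Away Qp
local notation3 "EQ" => Algebra.adjoin k ((algebraMap (MvPolynomial (Fin n) k) LQ) '' Egens ∪
    {(IsLocalization.Away.invSelf Qp : LQ)})
local notation3 "BT" => HomogeneousLocalization.Away (reesGrading I6)
    (reesT (tPrime k n a b c d) (tPrime_mem_I6 k n a b c d))
local notation3 (prettyPrint := false) "θT" =>
  HomogeneousLocalization.Away.mk (reesGrading I6) (reesT_mem (tPrime k n a b c d) (tPrime_mem_I6 k n a b c d)) 2
    (⟨monomial 2 (hPrime k n a b c ^ 3), reesAlgebra.monomial_mem.mpr (hPrime_cube_mem_I6_sq k n a b c)⟩ :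
      reesAlgebra I6)
    (monomial_two_mem_reesGrading k n
      (![X a ^ 2, X a * X b ^ 2, X a * X b * X c, X a * X c ^ 3, X b ^ 3, X b ^ 2 * X c ^ 2, X b * X c ^ 4,
        X c ^ 6] : Fin 8 → MvPolynomial (Fin n) k) (hPrime k n a b c ^ 3) (hPrime_cube_mem_I6_sq k n a b c))
local notation3 "BW" => HomogeneousLocalization.Away (reesGrading I6)
    (reesT (tPrime k n a b c d) (tPrime_mem_I6 k n a b c d) * hCubeT2 k n a b c)

/-! ## The model over ANY localisation `L` of `k[x]` at `Q`, in the letters `evenGens` / `twistedQ` -/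

/-- The engine's literal generating set IS `JordanFour.evenGens` (as sets). [OURS · L1 W4.5c] -/
theorem engineGens_eq_evenGens :
    (({X b ^ 2, X b * X a, X b * X c, X a ^ 2, X a * X c, X c ^ 2} : Set (MvPolynomial (Fin n) k)) ∪
        (fun i : Fin n => (X i : MvPolynomial (Fin n) k)) '' {i | i ≠ a ∧ i ≠ b ∧ i ≠ c}) =
      evenGens k n a b c := by
  rw [show (X b * X a : MvPolynomial (Fin n) k) = X a * X b from mul_comm _ _]
  simp only [evenGens]
  ext f
  simp only [Set.mem_union, Set.mem_insert_iff, Set.mem_singleton_iff]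
  tauto

/-- Transport of a subalgebra along an algebra isomorphism, as a ring isomorphism with its values.
[folklore] -/
theorem exists_subalgebra_ringEquiv_of_map_eq {R A B : Type*} [CommSemiring R] [Semiring A]
    [Semiring B] [Algebra R A] [Algebra R B] (φ : A ≃ₐ[R] B) (S : Subalgebra R A)
    (T : Subalgebra R B) (h : S.map (φ : A →ₐ[R] B) = T) :
    ∃ eφ : ↥S ≃+* ↥T, ∀ z : S, ((eφ z : T) : B) = φ (z : A) :=
  ⟨(φ.subalgebraMap S).toRingEquiv.trans (Subalgebra.equivOfEq _ _ h).toRingEquiv, fun _ => rfl⟩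

include hab hac had hbc hbd hcd in
/-- **T2(b) on `W_T`, in any model `L` of `k[x][1/Q]`** (the letters of res-type-036's
`JordanFour.exists_ringBrick_T_model`: `L` with `IsLocalization.Away (twistedQ k n a b d) L`,
`E = k[evenGens, 1/Q] ⊆ L`): `(k[x][I₆t])_{(T′t·H′³t²)} ≃+* E` with `F/1 ↦ ψ_T F` on the degree-`0`
elements, `(g_jt)/(T′t) ↦ q_j/Q`, `θ ↦ Q`. (Transport of `exists_chartW_away_ringEquiv_twistedChart`
along `IsLocalization.algEquiv : k[x][1/Qp] ≃ L`, `Qp = twistedQ`.) [OURS · L1 W4.5c] -/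
theorem exists_chartW_away_ringEquiv_evenModel (h2 : (2 : k) ≠ 0) (h3 : (3 : k) ≠ 0)
    (L : Type) [CommRing L] [Algebra k L] [Algebra (MvPolynomial (Fin n) k) L]
    [IsScalarTower k (MvPolynomial (Fin n) k) L] [IsLocalization.Away (twistedQ k n a b d) L] :
    ∃ e : BW ≃+* ↥(Algebra.adjoin k (algebraMap (MvPolynomial (Fin n) k) L '' evenGens k n a b c ∪
        {IsLocalization.Away.invSelf (S := L) (twistedQ k n a b d)})),
      (∀ F : MvPolynomial (Fin n) k,
        ((e (HomogeneousLocalization.fromZeroRingHom (reesGrading I6) _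
          (reesGrading.zeroRingHom I6 F)) : Algebra.adjoin k (algebraMap (MvPolynomial (Fin n) k) L ''
            evenGens k n a b c ∪ {IsLocalization.Away.invSelf (S := L) (twistedQ k n a b d)})) : L) =
          algebraMap (MvPolynomial (Fin n) k) L (twistedChart k n a b c d F)) ∧
      (∀ j : Fin 8,
        ((e (HomogeneousLocalization.awayMap (reesGrading I6) (hCubeT2_mem k n a b c)
          (rfl : reesT (tPrime k n a b c d) (tPrime_mem_I6 k n a b c d) * hCubeT2 k n a b c = _)
          (HomogeneousLocalization.Away.mk (reesGrading I6)
            (reesT_mem (tPrime k n a b c d) (tPrime_mem_I6 k n a b c d)) 1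
            (reesT (gI6 j) (Ideal.mem_span_range_self (f := gI6) (x := j))) (reesT_mem_one_smul gI6 j))) :
            Algebra.adjoin k (algebraMap (MvPolynomial (Fin n) k) L '' evenGens k n a b c ∪
              {IsLocalization.Away.invSelf (S := L) (twistedQ k n a b d)})) : L) =
          algebraMap (MvPolynomial (Fin n) k) L (twistedCofactor k n a b c d j) *
            IsLocalization.Away.invSelf (S := L) (twistedQ k n a b d)) ∧
      ((e (HomogeneousLocalization.awayMap (reesGrading I6) (hCubeT2_mem k n a b c)
          (rfl : reesT (tPrime k n a b c d) (tPrime_mem_I6 k n a b c d) * hCubeT2 k n a b c = _)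
          (θT : BT)) : Algebra.adjoin k (algebraMap (MvPolynomial (Fin n) k) L '' evenGens k n a b c ∪
            {IsLocalization.Away.invSelf (S := L) (twistedQ k n a b d)})) : L) =
        algebraMap (MvPolynomial (Fin n) k) L (twistedQ k n a b d) := by
  have hQ := twistedQ_eq_engineQ k n a b d
  -- `L` is also a localisation at the literal `Qp`
  haveI hL : IsLocalization.Away Qp L := by rw [← hQ]; infer_instance
  -- the transport `φ : k[x][1/Qp] ≃ₐ[k] L` (kept opaque: only its two values are used)
  obtain ⟨φ, hφalg, hφinv⟩ : ∃ φ : LQ ≃ₐ[k] L,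
      (∀ f : MvPolynomial (Fin n) k,
        φ (algebraMap (MvPolynomial (Fin n) k) LQ f) = algebraMap (MvPolynomial (Fin n) k) L f) ∧
      φ (IsLocalization.Away.invSelf (S := LQ) Qp) =
        IsLocalization.Away.invSelf (S := L) (twistedQ k n a b d) := by
    let φ₀ : LQ ≃ₐ[MvPolynomial (Fin n) k] L := IsLocalization.algEquiv (Submonoid.powers Qp) LQ L
    have hφalg : ∀ f : MvPolynomial (Fin n) k, φ₀.restrictScalars k (algebraMap (MvPolynomial (Fin n) k) LQ f) =
        algebraMap (MvPolynomial (Fin n) k) L f := fun f => φ₀.commutes f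
    refine ⟨φ₀.restrictScalars k, hφalg, ?_⟩
    have h1 : algebraMap (MvPolynomial (Fin n) k) L (twistedQ k n a b d) *
        φ₀.restrictScalars k (IsLocalization.Away.invSelf (S := LQ) Qp) = 1 := by
      rw [hQ, ← hφalg, ← map_mul, IsLocalization.Away.mul_invSelf, map_one]
    have h2' : IsLocalization.Away.invSelf (S := L) (twistedQ k n a b d) *
        algebraMap (MvPolynomial (Fin n) k) L (twistedQ k n a b d) = 1 := by
      rw [mul_comm]; exact IsLocalization.Away.mul_invSelf _
    exact (left_inv_eq_right_inv h2' h1).symm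
  -- the image of `E_Q` is `E`
  have hmap : (EQ).map (φ : LQ →ₐ[k] L) =
      Algebra.adjoin k (algebraMap (MvPolynomial (Fin n) k) L '' evenGens k n a b c ∪
        {IsLocalization.Away.invSelf (S := L) (twistedQ k n a b d)}) := by
    rw [AlgHom.map_adjoin, Set.image_union, Set.image_singleton, Set.image_image,
      ← engineGens_eq_evenGens k n a b c, AlgEquiv.coe_toAlgHom, hφinv]
    congr 2
    apply Set.image_congr
    intro f _
    exact hφalg f
  -- the induced isomorphism `E_Q ≃ E` over `φ`
  have hφE := exists_subalgebra_ringEquiv_of_map_eq φ _ _ hmap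
  obtain ⟨eφ, heφ⟩ := hφE
  have hex := exists_chartW_away_ringEquiv_twistedChart k n a b c d hab hac had hbc hbd hcd h2 h3
  obtain ⟨e, he1, he2, he3⟩ := hex
  refine ⟨e.trans eφ, fun F => ?_, fun j => ?_, ?_⟩
  · rw [RingEquiv.trans_apply, heφ, he1 F, hφalg]
  · rw [RingEquiv.trans_apply, heφ, he2 j, map_mul, hφalg, hφinv]
  · rw [RingEquiv.trans_apply, heφ, he3, hφalg, hQ]

end Summit.ResolutionOfSingularities.ResolutionOfSingularities.Theorems.WildQuotientResolution.JordanFour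

end
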